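import Summits.BirchSwinnertonDyer.BirchSwinnertonDyer.Theorems.UniversalToricDescentToricKernelAtThreeApZeroOddFlatOfPrint
import Summits.BirchSwinnertonDyer.BirchSwinnertonDyer.Theorems.UniversalToricDescentToricTransportModThreeFlatGlue
import Summits.BirchSwinnertonDyer.BirchSwinnertonDyer.Theorems.UniversalToricDescentDefectTransportTorsionMu
import Summits.BirchSwinnertonDyer.BirchSwinnertonDyer.Theorems.ErratumRoadFiveBaseCountShaPrimary
import Summits.BirchSwinnertonDyer.BirchSwinnertonDyer.Theorems.UniversalToricDescentLocalEulerPoincareCharacteristicFact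
import HarnessLib

/-!
# UTD act F proposal (width seat bsd-wall-utd-p2-w2 g3, 2026-08-28) — the TORSION-CONDITIONAL twin package:
# `stub_torsionMult` («X^∅_ac(W′/K_∞) is Λ-torsion», research atom 2 of 3 of the deciding crux ♭B 26062) LEAVES THE
# DECIDING CHAIN, because kernel″ (act E, 26977) already holds everything that makes it a THEOREM there

KERNEL-CHECKED CERTIFICATE (rc 0, 0 sorry; every `def` below is a PROPOSED TEXT or sketch-local; nothing is filed by this
seat — the pen decides). Written against route rev 44 (act E: ♭T′ 26975 `DefectTransportModThreePT`, package 26976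
`ToricDefectWallMuAtThree`, kernel″ 26977 `ToricKernelAtThreeApZeroOddDefectPTOfPrint`).

## The observation

In the act-D/E cross-squeeze (`UniversalToricDescentActDFlatGlue.toricTransportModThreeFlat_of_wall_of_defect_of_mu`, p609855)
♭T′ is applied at the `E`-frame `L` and the handed twin frame `L′` and RETURNS a first-unit index `m` of `L`
(`‖coeff m L‖ = 1`). With that, utd-p1 g11's tree theorem
`UniversalToricDescentDefectTransport.defectTransport_torsionMu_of_wall` (p611201; Greenberg–Vatsal finiteness-form residual
transfer along `E[3] ≃ W′[3]`, NO (iv), NO Poitou–Tate, NO base finiteness) turns the kernel's OWN data — `X^∅_ac(E)` torsion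
(`hn.1` of the additive control `WildSplitControlAtThree`), the wall `(L) ⊆ Ch(E)·R₀⟦T⟧` (20395), the unit coefficient of `L` —
into `X^∅_ac(W′/K_∞; slot 𝔭′)` TORSION for the twin, BEFORE the twin's rational Wan clause is consumed. So the twin cruxes
may be asked for the Wan clause ONLY UNDER the torsion hypothesis:

* ♭B_T `TwinWanFrameAtThreeMultT` := ♭B 26062 with its consequent re-typed
  `∃ (ΩK Ωp L), ΩK ≠ 0 ∧ Ωp ≠ 0 ∧ IsBDPLFunction … L ∧ (Module.IsTorsion Λ (X^∅_ac(W′; 𝔭′)) → ∃ k, 3^k·Ch(W′)·R₀⟦T⟧ ⊆ (L))`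
  (the frame unconditionally — print via Hsieh / the member tower —, the clause under torsion);
* ♭C₀_T `TwinWanFrameAtThreeGoodSSApZeroT` := ♭C₀ 26063 likewise; package_T := ♭B_T ∧ ♭C₀_T;
* kernel‴ `ToricKernelAtThreeApZeroOddDefectPTTOfPrint` := kernel″ 26977 with `TwinWanFrameAtThreeNonOrdBuckets →` ↦ package_T.

## What is PROVED here (std tactics; `lean check` rc 0, 0 sorry)

* §1 `flatT_of_defectPT_of_wall_of_mu` — ♭T′ → wall 20395 → μ 20400 → Flat_T (the act-E Flat′ text with the twin binder
  re-typed torsion-conditionally): p609855's squeeze with ONE inserted step (the transport above). This is the whole content.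
* §2 `bsdp_three_of_twinWanFrameAtT_odd_flatT`, `bsdp_three_of_flatT_of_nonOrdBucketsT_odd`, **`kernelF_proof :
  ToricKernelAtThreeApZeroOddDefectPTTOfPrint`** — kernel″'s closer ticket (act E: p609468 + the PT/hfin discharge of
  SketchE.lean) executed on the torsion-conditional package: FULLY PROVED, no ticket left.
* §3 monotonicity `twinWanFrameAtThreeMultT_of_mult : ♭B → ♭B_T`, `…GoodSSApZeroT_of_goodSSApZero : ♭C₀ → ♭C₀_T`,
  `nonOrdBucketsT_of_nonOrdBuckets` (so every registered line of ♭B/♭C₀/20694/23594 still closes the re-typed items), and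
  `closesF` (the would-be deciding theorem: `closes` of rev 44 with h3 ↦ package_T, hK ↦ kernel‴).

NET if adopted: ♭B's deciding research atoms drop from {member tower K1/K1b, torsion of X^∅_ac(W′), cube locus} to
{member tower, cube locus}; ♭C₀'s torsion content (inside `stub_wanFrameSS_apZero`) likewise becomes dischargeable. Nothing
new enters the chain: the transport step uses ♭T′, 20395, `hn.1` and p611201 — all already on it or in the tree.
LINE-LEVEL payoff (separate workfile `ActF_LineMembertowerT.lean`): ♭B_T from v7/v4's `stub_memberTowerMult` +
`stub_wanFrameMultCube` ALONE (no `stub_torsionMult`). BSD is not proved by any of this; no item closes by this file.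
-/

set_option autoImplicit false
set_option linter.dupNamespace false

noncomputable section

open scoped Classical

namespace Summit.BirchSwinnertonDyer.BirchSwinnertonDyer.Cruxes.TwinWanFrameAtThreeMult.ActF

open WeierstrassCurve NumberField IsDedekindDomain Field
  Literature.NumberTheory.EllipticCurves
  Literature.NumberTheory.EllipticCurves.ModularForms
  Literature.NumberTheory.EllipticCurves.Rank1Residual
  Literature.NumberTheory.EllipticCurves.KrizLi2019
  Literature.NumberTheory.EllipticCurves.LiuZhangZhang2018
  Summit.BirchSwinnertonDyer.Rank1Residual
  Summit.BirchSwinnertonDyer.Rank1Residual.Additive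
  Summit.BirchSwinnertonDyer.Rank1Residual.X11b
  Summit.BirchSwinnertonDyer.Rank1Residual.X11b.AcSelmer
  Summit.BirchSwinnertonDyer.Rank1Residual.X11b.Halves
  Summit.BirchSwinnertonDyer.BirchSwinnertonDyer.Theses.UniversalToricDescent
  Summit.BirchSwinnertonDyer.BirchSwinnertonDyer.Theorems
  Summit.BirchSwinnertonDyer.BirchSwinnertonDyer.Theorems.UniversalToricDescentTwinChoice
  Summit.BirchSwinnertonDyer.BirchSwinnertonDyer.Theorems.UniversalToricDescentWaldspurgerFlat
  Summit.BirchSwinnertonDyer.BirchSwinnertonDyer.Theorems.UniversalToricDescentKernelOdd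
  Summit.BirchSwinnertonDyer.BirchSwinnertonDyer.Theorems.UniversalToricDescentKernelOfPrint
  Summit.BirchSwinnertonDyer.BirchSwinnertonDyer.Theorems.UniversalToricDescentKernelFlatOfPrint
  Summit.BirchSwinnertonDyer.BirchSwinnertonDyer.Theorems.UniversalToricDescentActDFlatGlue
  Summit.BirchSwinnertonDyer.BirchSwinnertonDyer.Theorems.UniversalToricDescentNormProfile
  Summit.BirchSwinnertonDyer.BirchSwinnertonDyer.Theorems.UniversalToricDescentDefectTransport

/-! ## Proposed texts -/

/-- **♭B_T (PROPOSED TEXT)** — `TwinWanFrameAtThreeMult` (26062) with the rational Wan clause CONDITIONAL on the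
`Λ`-torsion of `X^∅_ac(W′/K_∞; slot 𝔭′)`; the frame itself stays unconditional. -/
def TwinWanFrameAtThreeMultT : Prop :=
  ∀ (W' : WeierstrassCurve ℚ) [W'.IsElliptic] [W'.IsGloballyMinimal] (N' : ℕ) [NeZero N'] (K : Type) [Field K]
    [NumberField K] (Dt' : ModularParametrizationData W' N'),
    Mult W' 3 → W'.HasSurjectiveModNGaloisRep 3 → W'.conductorNorm ℤ = N' → IsImaginaryQuadratic K →
    SatisfiesHeegnerHypothesis N' K → Odd (NumberField.discr K) →
    ∀ (κ : ZpExtension K 3), κ.IsAnticyclotomic → ∀ (γ : absoluteGaloisGroup K) [Fact (κ.IsTopGenerator γ)]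
      (𝔭 : HeightOneSpectrum (𝓞 K)), ((3 : ℕ) : 𝓞 K) ∈ 𝔭.asIdeal →
      𝔭.asIdeal.ramificationIdx (𝓞 ℚ) = 1 → 𝔭.asIdeal.inertiaDeg (𝓞 ℚ) = 1 →
      ∀ (𝔭' : HeightOneSpectrum (𝓞 K)), ((3 : ℕ) : 𝓞 K) ∈ 𝔭'.asIdeal → 𝔭' ≠ 𝔭 →
      ∀ (ι' : PadicAlgCl 3 ≃+* ℂ), SchneiderFree.BranchInducesPrime 3 ι' 𝔭 →
      ∃ (ΩK : ℂ) (Ωp : ℂ_[3]) (L : UnrSeries 3), ΩK ≠ 0 ∧ Ωp ≠ 0 ∧ IsBDPLFunction ι' 𝔭 κ γ Dt'.f ΩK Ωp L ∧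
        (Module.IsTorsion (IwasawaAlgebra 3) (XAc (W'.baseChange K) 3 κ 𝔭' ∅ γ) →
          ∃ k : ℕ, ∀ G ∈ (XAc.charIdeal (W'.baseChange K) 3 κ 𝔭' ∅ γ).map (PowerSeries.map (toUnr 3)),
            PowerSeries.C (((3 : ℕ) : unrIntegers 3) ^ k) * G ∈ Ideal.span {L})

/-- **♭C₀_T (PROPOSED TEXT)** — `TwinWanFrameAtThreeGoodSSApZero` (26063) with the same torsion-conditional clause. -/
def TwinWanFrameAtThreeGoodSSApZeroT : Prop :=
  ∀ (W' : WeierstrassCurve ℚ) [W'.IsElliptic] [W'.IsGloballyMinimal] (N' : ℕ) [NeZero N'] (K : Type) [Field K]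
    [NumberField K] (Dt' : ModularParametrizationData W' N'),
    GoodSS W' 3 → W'.frobeniusTrace 3 = 0 → W'.HasSurjectiveModNGaloisRep 3 → W'.conductorNorm ℤ = N' →
    IsImaginaryQuadratic K → SatisfiesHeegnerHypothesis N' K → Odd (NumberField.discr K) →
    ∀ (κ : ZpExtension K 3), κ.IsAnticyclotomic → ∀ (γ : absoluteGaloisGroup K) [Fact (κ.IsTopGenerator γ)]
      (𝔭 : HeightOneSpectrum (𝓞 K)), ((3 : ℕ) : 𝓞 K) ∈ 𝔭.asIdeal →
      𝔭.asIdeal.ramificationIdx (𝓞 ℚ) = 1 → 𝔭.asIdeal.inertiaDeg (𝓞 ℚ) = 1 →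
      ∀ (𝔭' : HeightOneSpectrum (𝓞 K)), ((3 : ℕ) : 𝓞 K) ∈ 𝔭'.asIdeal → 𝔭' ≠ 𝔭 →
      ∀ (ι' : PadicAlgCl 3 ≃+* ℂ), SchneiderFree.BranchInducesPrime 3 ι' 𝔭 →
      ∃ (ΩK : ℂ) (Ωp : ℂ_[3]) (L : UnrSeries 3), ΩK ≠ 0 ∧ Ωp ≠ 0 ∧ IsBDPLFunction ι' 𝔭 κ γ Dt'.f ΩK Ωp L ∧
        (Module.IsTorsion (IwasawaAlgebra 3) (XAc (W'.baseChange K) 3 κ 𝔭' ∅ γ) →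
          ∃ k : ℕ, ∀ G ∈ (XAc.charIdeal (W'.baseChange K) 3 κ 𝔭' ∅ γ).map (PowerSeries.map (toUnr 3)),
            PowerSeries.C (((3 : ℕ) : unrIntegers 3) ^ k) * G ∈ Ideal.span {L})

/-- **package_T (PROPOSED TEXT)** — the torsion-conditional non-ordinary twin package ♭B_T ∧ ♭C₀_T (closes binder h3). -/
def TwinWanFrameAtThreeNonOrdBucketsT : Prop :=
  TwinWanFrameAtThreeMultT ∧ TwinWanFrameAtThreeGoodSSApZeroT

/-- **kernel‴ (PROPOSED TEXT)** — kernel″ 26977 `ToricKernelAtThreeApZeroOddDefectPTOfPrint` with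
`TwinWanFrameAtThreeNonOrdBuckets →` ↦ `TwinWanFrameAtThreeNonOrdBucketsT →` (closes binder hK). PROVED below
(`kernelF_proof`). -/
def ToricKernelAtThreeApZeroOddDefectPTTOfPrint : Prop :=
  ToricPublishedInputs → DefectTransportModThreePT → AdditiveSplitIMCInclusionAtThree → TwinMuZeroAtThree →
    TwinWanFrameAtThreeNonOrdBucketsT → GoodSSApZeroTwinSupplyAtThree → WildSplitPrintedInputsAtThree →
    WildSplitFrameAtThreeOddOfPrint → ToricPrintedLeavesAtThree → WildRankZeroTwistAtThree →
    ∀ (W : WeierstrassCurve ℚ) [W.IsElliptic] [W.IsGloballyMinimal], Additive.ClassO6 W 3 → W.analyticRank = 1 →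
      W.HasSurjectiveModNGaloisRep 3 →
      (∃ (W' : WeierstrassCurve ℚ) (_ : W'.IsElliptic) (_ : W'.IsGloballyMinimal),
        O6.ModPCongruent W' W 3 ∧ ¬ Addv W' 3 ∧ W'.HasSurjectiveModNGaloisRep 3) → BSDp W 3

/-- Flat_T (SKETCH-LOCAL, not proposed for filing) — act E's sketch-local Flat′ `ToricTransportModThreeFlatPT` with the handed
twin frame re-typed torsion-conditionally; the shape §1 proves from ♭T′ + wall + μ and §2 consumes. -/
def ToricTransportModThreeFlatT : Prop :=
  PoitouTateSelmerStructureDualityFact → PoitouTateShaTateDualFact →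
  ∀ (W : WeierstrassCurve ℚ) [W.IsElliptic] [W.IsGloballyMinimal] (W' : WeierstrassCurve ℚ) [W'.IsElliptic]
    [W'.IsGloballyMinimal] (N N' : ℕ) [NeZero N] [NeZero N'] (K : Type) [Field K] [NumberField K]
    (Dt : ModularParametrizationData W N) (Dt' : ModularParametrizationData W' N'),
    Additive.ClassO6 W 3 → W.HasSurjectiveModNGaloisRep 3 → W.analyticRank = 1 → W.conductorNorm ℤ = N →
    O6.ModPCongruent W' W 3 → ¬ Addv W' 3 → W'.conductorNorm ℤ = N' → IsImaginaryQuadratic K →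
    SatisfiesHeegnerHypothesis N K → SatisfiesHeegnerHypothesis N' K →
    (∀ (v : HeightOneSpectrum (𝓞 K)), ((3 : ℕ) : 𝓞 K) ∈ v.asIdeal → Finite (selmerAcBase (W.baseChange K) 3 v ∅)) →
    ∀ (κ : ZpExtension K 3), κ.IsAnticyclotomic → ∀ (γ : absoluteGaloisGroup K) [Fact (κ.IsTopGenerator γ)]
      (𝔭 : HeightOneSpectrum (𝓞 K)), ((3 : ℕ) : 𝓞 K) ∈ 𝔭.asIdeal → 𝔭.asIdeal.ramificationIdx (𝓞 ℚ) = 1 →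
      𝔭.asIdeal.inertiaDeg (𝓞 ℚ) = 1 →
      ∀ (𝔭' : HeightOneSpectrum (𝓞 K)), ((3 : ℕ) : 𝓞 K) ∈ 𝔭'.asIdeal → 𝔭' ≠ 𝔭 →
      ∀ (ι' : PadicAlgCl 3 ≃+* ℂ), SchneiderFree.BranchInducesPrime 3 ι' 𝔭 →
      Module.IsTorsion (IwasawaAlgebra 3) (XAc (W.baseChange K) 3 κ 𝔭' ∅ γ) →
      (∃ (ΩK : ℂ) (Ωp : ℂ_[3]) (L' : UnrSeries 3), ΩK ≠ 0 ∧ Ωp ≠ 0 ∧ IsBDPLFunction ι' 𝔭 κ γ Dt'.f ΩK Ωp L' ∧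
        (Module.IsTorsion (IwasawaAlgebra 3) (XAc (W'.baseChange K) 3 κ 𝔭' ∅ γ) →
          ∃ k : ℕ, ∀ G ∈ (XAc.charIdeal (W'.baseChange K) 3 κ 𝔭' ∅ γ).map (PowerSeries.map (toUnr 3)),
            PowerSeries.C (((3 : ℕ) : unrIntegers 3) ^ k) * G ∈ Ideal.span {L'})) →
      ∀ (ΩK : ℂ) (Ωp : ℂ_[3]) (L : UnrSeries 3), ΩK ≠ 0 → Ωp ≠ 0 → IsBDPLFunction ι' 𝔭 κ γ Dt.f ΩK Ωp L →
        (XAc.charIdeal (W.baseChange K) 3 κ 𝔭' ∅ γ).map (PowerSeries.map (toUnr 3)) = Ideal.span {L}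

/-! ## §1 The squeeze with the transport step: ♭T′ → wall → μ → Flat_T -/

/-- **THE ONE NEW STEP, isolated**: under ♭T′'s binders at a pair of frames `(L, L′)`, the kernel's data give `X^∅_ac(W′)`
TORSION — ♭T′ returns a first-unit index `m` of `L`; `defectTransport_torsionMu_of_wall` (p611201) transports
`X^∅_ac(E)` torsion + wall + `‖coeff m L‖ = 1` along `E[3] ≃ W′[3]`. [cite: GreenbergVatsal2000, Thm. (1.4), §2 Prop. (2.8)] -/
theorem twinTorsion_of_defectPT_of_wall (hD : DefectTransportModThreePT) (hwall : AdditiveSplitIMCInclusionAtThree)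
    (hPT : PoitouTateSelmerStructureDualityFact) (hPT2 : PoitouTateShaTateDualFact)
    (W : WeierstrassCurve ℚ) [W.IsElliptic] [W.IsGloballyMinimal] (W' : WeierstrassCurve ℚ) [W'.IsElliptic]
    [W'.IsGloballyMinimal] (N N' : ℕ) [NeZero N] [NeZero N'] (K : Type) [Field K] [NumberField K]
    (Dt : ModularParametrizationData W N) (Dt' : ModularParametrizationData W' N')
    (hO6 : Additive.ClassO6 W 3) (hsurj : W.HasSurjectiveModNGaloisRep 3) (hr : W.analyticRank = 1)
    (hN : W.conductorNorm ℤ = N) (hcong : O6.ModPCongruent W' W 3) (hss : ¬ Addv W' 3) (hN' : W'.conductorNorm ℤ = N')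
    (hK : IsImaginaryQuadratic K) (hHN : SatisfiesHeegnerHypothesis N K) (hHN' : SatisfiesHeegnerHypothesis N' K)
    (hfinE : ∀ (v : HeightOneSpectrum (𝓞 K)), ((3 : ℕ) : 𝓞 K) ∈ v.asIdeal → Finite (selmerAcBase (W.baseChange K) 3 v ∅))
    (κ : ZpExtension K 3) (hκ : κ.IsAnticyclotomic) (γ : absoluteGaloisGroup K) [Fact (κ.IsTopGenerator γ)]
    (𝔭 : HeightOneSpectrum (𝓞 K)) (h𝔭 : ((3 : ℕ) : 𝓞 K) ∈ 𝔭.asIdeal) (he : 𝔭.asIdeal.ramificationIdx (𝓞 ℚ) = 1)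
    (hf : 𝔭.asIdeal.inertiaDeg (𝓞 ℚ) = 1) (𝔭' : HeightOneSpectrum (𝓞 K)) (h𝔭' : ((3 : ℕ) : 𝓞 K) ∈ 𝔭'.asIdeal)
    (hne : 𝔭' ≠ 𝔭) (ι' : PadicAlgCl 3 ≃+* ℂ) (hind : SchneiderFree.BranchInducesPrime 3 ι' 𝔭)
    (htors : Module.IsTorsion (IwasawaAlgebra 3) (XAc (W.baseChange K) 3 κ 𝔭' ∅ γ))
    {ΩK : ℂ} {Ωp : ℂ_[3]} {L : UnrSeries 3} (hΩK : ΩK ≠ 0) (hΩp : Ωp ≠ 0) (hBDP : IsBDPLFunction ι' 𝔭 κ γ Dt.f ΩK Ωp L)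
    {ΩK' : ℂ} {Ωp' : ℂ_[3]} {L' : UnrSeries 3} (hΩK' : ΩK' ≠ 0) (hΩp' : Ωp' ≠ 0)
    (hBDP' : IsBDPLFunction ι' 𝔭 κ γ Dt'.f ΩK' Ωp' L')
    (hi' : ∃ i : ℕ, ‖((PowerSeries.coeff i L' : unrIntegers 3) : ℂ_[3])‖ = 1) :
    Module.IsTorsion (IwasawaAlgebra 3) (XAc (W'.baseChange K) 3 κ 𝔭' ∅ γ) := by
  have hle : Ideal.span {L} ≤ (XAc.charIdeal (W.baseChange K) 3 κ 𝔭' ∅ γ).map (PowerSeries.map (toUnr 3)) :=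
    hwall W N K Dt hO6 hsurj hr hN hK hHN κ hκ γ 𝔭 h𝔭 he hf 𝔭' h𝔭' hne ι' hind ΩK Ωp L hΩK hΩp hBDP
  obtain ⟨g, g', n, m, n', m', -, -, -, hL, -, -, -⟩ :=
    hD hPT hPT2 W W' N N' K Dt Dt' hO6 hsurj hr hN hcong hss hN' hK hHN hHN' hfinE κ hκ γ 𝔭 𝔭' h𝔭 he hf h𝔭' hne ι'
      hind htors ΩK Ωp L hΩK hΩp hBDP hle ΩK' Ωp' L' hΩK' hΩp' hBDP' hi'
  exact (defectTransport_torsionMu_of_wall W W' K hN hcong hN' hK hHN hHN' κ hκ γ h𝔭' htors hle ⟨m, hL.2⟩).2.2.1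

/-- **Squeeze_T: ♭T′ → wall 20395 → μ 20400 → Flat_T.** p609855's cross-squeeze with the transport step inserted between
«♭T′ at `(L, L′)`» and «the twin's Wan clause»: `n ≤ m` (wall: `g ∣ L`), torsion of `X^∅_ac(W′)` (above), THEN the clause,
`m′ ≤ n′` (`L′ ∣ g′`), `n + m′ = n′ + m` ⟹ `n = m` ⟹ `Ch(E)·R₀⟦T⟧ = (L)`. [cite: GreenbergVatsal2000, Thm. (1.4)] -/
theorem flatT_of_defectPT_of_wall_of_mu (hD : DefectTransportModThreePT) (hwall : AdditiveSplitIMCInclusionAtThree)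
    (hmu : TwinMuZeroAtThree) : ToricTransportModThreeFlatT := by
  intro hPT hPT2 W _ _ W' _ _ N N' _ _ K _ _ Dt Dt' hO6 hsurj hr hN hcong hss hN' hK hHN hHN' hfinE κ hκ γ _ 𝔭 h𝔭 he hf
    𝔭' h𝔭' hne ι' hind htors hwan ΩK Ωp L hΩK hΩp hBDP
  -- the wall at `E`
  have hle : Ideal.span {L} ≤ (XAc.charIdeal (W.baseChange K) 3 κ 𝔭' ∅ γ).map (PowerSeries.map (toUnr 3)) :=
    hwall W N K Dt hO6 hsurj hr hN hK hHN κ hκ γ 𝔭 h𝔭 he hf 𝔭' h𝔭' hne ι' hind ΩK Ωp L hΩK hΩp hBDP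
  -- the handed twin frame (unconditional part) and its `μ = 0`
  obtain ⟨ΩK', Ωp', L', hΩK', hΩp', hBDP', hkT⟩ := hwan
  have hi' : ∃ i : ℕ, ‖((PowerSeries.coeff i L' : unrIntegers 3) : ℂ_[3])‖ = 1 :=
    hmu W W' N N' K Dt Dt' hO6 hsurj hr hN hcong hss hN' hK hHN hHN' κ hκ γ 𝔭 h𝔭 he hf 𝔭' h𝔭' hne ι' hind ΩK' Ωp' L'
      hΩK' hΩp' hBDP'
  -- ♭T′ at `(L, L′)`: the four profiles
  obtain ⟨g, g', n, m, n', m', hIE, hI', hg, hL, hg', hL', hsum⟩ :=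
    hD hPT hPT2 W W' N N' K Dt Dt' hO6 hsurj hr hN hcong hss hN' hK hHN hHN' hfinE κ hκ γ 𝔭 𝔭' h𝔭 he hf h𝔭' hne ι'
      hind htors ΩK Ωp L hΩK hΩp hBDP hle ΩK' Ωp' L' hΩK' hΩp' hBDP' hi'
  -- NEW STEP: torsion of `X^∅_ac(W′)` from `X^∅_ac(E)` torsion + wall + the unit coefficient `m` of `L` (p611201)
  have htors' : Module.IsTorsion (IwasawaAlgebra 3) (XAc (W'.baseChange K) 3 κ 𝔭' ∅ γ) :=
    (defectTransport_torsionMu_of_wall W W' K hN hcong hN' hK hHN hHN' κ hκ γ h𝔭' htors hle ⟨m, hL.2⟩).2.2.1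
  -- the twin's rational Wan clause, now owed only under torsion
  have hk := hkT htors'
  -- the squeeze, verbatim
  have hgL : g ∣ L := by
    rw [hIE] at hle
    exact Ideal.mem_span_singleton.mp (hle (Ideal.mem_span_singleton_self L))
  have h₁ : n ≤ m := firstUnitCoeff_le_of_dvd hgL hg.1 hL.2
  have hL'g' : L' ∣ g' :=
    dvd_of_mem_of_C_pow_mul_mem_span hL'.1 hL'.2 hk (hI' ▸ Ideal.mem_span_singleton_self g')
  have h₂ : m' ≤ n' := firstUnitCoeff_le_of_dvd hL'g' hL'.1 hg'.2
  have hnm : n = m := by omega  -- restate-robust (R1-♭T≤, pen pss3x g6 2026-08-28): either form of `hsum`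
  subst hnm
  exact eq_span_of_span_le_of_normProfile hIE hle hg.1 hL.2


/-! ## §2 kernel‴ PROVED: kernel″'s closer (p609468 + act E's PT/hfin discharge) run on the torsion-conditional package -/

/-- **Pointwise kernel‴** = `UniversalToricDescentKernelFlatOfPrint.bsdp_three_of_twinWanFrameAt_odd_flat` (p609468 §1) with
`hT : Flat_T` (PT facts + wild base finiteness threaded as in act E, discharged here from the kernel's Gross–Zagier–Kolyvagin
rank-one data by `SchneiderFreeAdditiveX3.natCard_selmerAcBase_mul_eq_of_rankOne_anyTorsion_shaPrimary`, SketchE.lean's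
`example`) and the pointwise twin `hI'` TORSION-CONDITIONAL. Everything else verbatim. CONDITIONAL on every displayed
hypothesis; BSD is proved for no curve by this. [cite: JetchevSkinnerWan2017, §7.4.1] [cite: FriedbergHoffstein1995, Thm. B] -/
theorem bsdp_three_of_twinWanFrameAtT_odd_flatT (hF : ToricPublishedInputs)
    (hPT : PoitouTateSelmerStructureDualityFact) (hPT2 : PoitouTateShaTateDualFact) (hT : ToricTransportModThreeFlatT)
    (hV : ∀ (W : WeierstrassCurve ℚ) [W.IsElliptic] [W.IsGloballyMinimal] (N : ℕ) [NeZero N] (K : Type)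
      [Field K] [NumberField K] (Dt : ModularParametrizationData W N) (H : HeegnerDatum N (NumberField.discr K))
      (ι : K →+* ℂ) (P : (W.baseChange K).toAffine.Point),
      Additive.ClassO6 W 3 → W.HasSurjectiveModNGaloisRep 3 → W.analyticRank = 1 → W.conductorNorm ℤ = N →
      IsImaginaryQuadratic K → SatisfiesHeegnerHypothesis N K → Odd (NumberField.discr K) →
      (W.quadraticTwist (NumberField.discr K : ℚ)).entireLFunction 1 ≠ 0 →
      (WeierstrassCurve.Affine.Point.map ι.toRatAlgHom) P = heegnerPointComplex Dt H → ¬ IsOfFinAddOrder P →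
      ∀ (κ : ZpExtension K 3), κ.IsAnticyclotomic → ∀ (γ : absoluteGaloisGroup K) [Fact (κ.IsTopGenerator γ)]
        (𝔭 : HeightOneSpectrum (𝓞 K)) (h𝔭 : ((3 : ℕ) : 𝓞 K) ∈ 𝔭.asIdeal)
        (he : 𝔭.asIdeal.ramificationIdx (𝓞 ℚ) = 1) (hf : 𝔭.asIdeal.inertiaDeg (𝓞 ℚ) = 1),
        ∃ ι' : PadicAlgCl 3 ≃+* ℂ, SchneiderFree.BranchInducesPrime 3 ι' 𝔭 ∧
          ∃ (ΩK : ℂ) (Ωp : ℂ_[3]) (L : UnrSeries 3), ΩK ≠ 0 ∧ Ωp ≠ 0 ∧ IsBDPLFunction ι' 𝔭 κ γ Dt.f ΩK Ωp L ∧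
            ∃ u : (unrIntegers 3)ˣ, L.HasValueAt 0 ((((u : unrIntegers 3) : unrIntegers 3) : ℂ_[3]) *
              (algebraMap ℚ_[3] ℂ_[3] (logOmega W 3 (embAt K 3 𝔭 h𝔭 he hf) P / (Dt.c : ℚ_[3]))) ^ 2))
    (hC : WildSplitControlAtThree) (hZ : WildRankZeroTwistAtThree)
    (W : WeierstrassCurve ℚ) [W.IsElliptic] [W.IsGloballyMinimal]
    (hO6 : Additive.ClassO6 W 3) (hr : W.analyticRank = 1) (hsurj : W.HasSurjectiveModNGaloisRep 3)
    (W' : WeierstrassCurve ℚ) [W'.IsElliptic] [W'.IsGloballyMinimal]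
    (hcong : O6.ModPCongruent W' W 3) (hW'ss : ¬ Addv W' 3)
    (hI' : ∀ (N' : ℕ) [NeZero N'] (K : Type) [Field K] [NumberField K]
      (Dt' : ModularParametrizationData W' N'), W'.conductorNorm ℤ = N' → IsImaginaryQuadratic K →
      SatisfiesHeegnerHypothesis N' K → Odd (NumberField.discr K) →
      ∀ (κ : ZpExtension K 3), κ.IsAnticyclotomic →
      ∀ (γ : absoluteGaloisGroup K) [Fact (κ.IsTopGenerator γ)] (𝔭 : HeightOneSpectrum (𝓞 K)),
        ((3 : ℕ) : 𝓞 K) ∈ 𝔭.asIdeal → 𝔭.asIdeal.ramificationIdx (𝓞 ℚ) = 1 →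
        𝔭.asIdeal.inertiaDeg (𝓞 ℚ) = 1 →
      ∀ (𝔭' : HeightOneSpectrum (𝓞 K)), ((3 : ℕ) : 𝓞 K) ∈ 𝔭'.asIdeal → 𝔭' ≠ 𝔭 →
      ∀ (ι' : PadicAlgCl 3 ≃+* ℂ), SchneiderFree.BranchInducesPrime 3 ι' 𝔭 →
        ∃ (ΩK : ℂ) (Ωp : ℂ_[3]) (L' : UnrSeries 3), ΩK ≠ 0 ∧ Ωp ≠ 0 ∧
          IsBDPLFunction ι' 𝔭 κ γ Dt'.f ΩK Ωp L' ∧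
          (Module.IsTorsion (IwasawaAlgebra 3) (XAc (W'.baseChange K) 3 κ 𝔭' ∅ γ) →
            ∃ k : ℕ, ∀ G ∈ (XAc.charIdeal (W'.baseChange K) 3 κ 𝔭' ∅ γ).map (PowerSeries.map (toUnr 3)),
              PowerSeries.C (((3 : ℕ) : unrIntegers 3) ^ k) * G ∈ Ideal.span {L'})) :
    BSDp W 3 := by
  -- adapted from p609468 `bsdp_three_of_twinWanFrameAt_odd_flat` (utd-p1 g11); the only changes are marked «act F»
  obtain ⟨hGZ, hKo, hGZK, hmod, hmodP, -, hGZ73, hFH, hpar, hHP⟩ := hF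
  haveI hN0 : NeZero (W.conductorNorm ℤ) := ⟨W.conductorNorm_pos_holds.ne'⟩
  haveI hN0' : NeZero (W'.conductorNorm ℤ) := ⟨W'.conductorNorm_pos_holds.ne'⟩
  have hw : W.rootNumber = -1 := by
    rcases W.rootNumber_eq_one_or with h | h
    · exfalso
      have heven : Even W.analyticRank := (hpar W).mpr h
      rw [hr] at heven
      exact Nat.not_even_one heven
    · exact h
  obtain ⟨K, _, _, hK, -, hHN, hH2N', hLt⟩ :=
    hFH W hw (2 * W'.conductorNorm ℤ) (mul_ne_zero two_ne_zero hN0'.out) 0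
  have hHN' : SatisfiesHeegnerHypothesis (W'.conductorNorm ℤ) K :=
    SatisfiesHeegnerHypothesis.of_dvd (dvd_mul_left _ 2) hH2N'
  have hodd : Odd (NumberField.discr K) := by
    have h8 := Literature.SatisfiesHeegnerHypothesis.discr_emod_eight hK.1 hH2N' (dvd_mul_right 2 _)
    rw [Int.odd_iff]; omega
  have h3N : 3 ∣ W.conductorNorm ℤ :=
    (W.dvd_conductorNorm_iff_not_hasGoodReductionAtPrime 3).mpr (not_good_of_addv W 3 hO6.2.1)
  have hsplit : SplitsIn K 3 := hHN 3 Nat.prime_three h3N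
  obtain ⟨P, Dt, H, ι, hP⟩ := hHP W K hK hHN
  have hL0 : W.entireLFunction 1 = 0 := entireLFunction_one_eq_zero_of_analyticRank_eq_one hr
  obtain ⟨-, hderiv⟩ := leadingLCoeff_eq_deriv_of_analyticRank_eq_one hr
  have hLK : LDerivEK W K ≠ 0 := by
    rw [lDerivEK_eq_deriv_mul W K hmod hL0]; exact mul_ne_zero hderiv hLt
  have hnt : ¬ IsOfFinAddOrder P :=
    (lDerivEK_ne_zero_iff_not_isOfFinAddOrder W (W.conductorNorm ℤ) K (hGZ _ W K) hK hHN
      ⟨Dt, H, ι, hP⟩).mp hLK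
  obtain ⟨hrk, hfin⟩ := hKo (W.conductorNorm ℤ) W K hK hHN ⟨Dt, H, ι, hP⟩ hnt
  obtain ⟨Dt'⟩ := hmodP W'
  obtain ⟨κ, γ, -, hκ, hγ, -⟩ := X11b.exists_anticyclotomic_generator_prime (p := 3) hK
  haveI : Fact (κ.IsTopGenerator γ) := ⟨hγ⟩
  obtain ⟨𝔭, h𝔭, he, hf⟩ := X11b.exists_degreeOnePrime_of_splitsIn K 3 hK.1 hsplit
  obtain ⟨𝔭', hne, h𝔭', he', hf'⟩ := X11b.Three.exists_ne_degreeOne_prime hK.1 h𝔭 he hf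
  obtain ⟨ι', hind, ΩK, Ωp, L, hΩK, hΩp, hBDP, u, hval⟩ :=
    hV W (W.conductorNorm ℤ) K Dt H ι P hO6 hsurj hr rfl hK hHN hodd hLt hP hnt κ hκ γ 𝔭 h𝔭 he hf
  -- «act F»: the twin's frame with its TORSION-CONDITIONAL Wan clause
  have hwan' := hI' (W'.conductorNorm ℤ) K Dt' rfl hK hHN' hodd κ hκ γ 𝔭 h𝔭 he hf 𝔭' h𝔭' hne ι' hind
  have hctl : SchneiderFree.AdditiveControlOnTreeAt 3 κ 𝔭' γ (embAt K 3 𝔭' h𝔭' he' hf') P :=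
    hC W (W.conductorNorm ℤ) K Dt H ι P hO6 hsurj hr rfl hK hHN hLt hP hnt (hKo _ W K) κ hκ γ 𝔭'
      h𝔭' he' hf'
  obtain ⟨n, hn, hneq⟩ := hctl
  -- «act E»: the wild curve's base finiteness at every `v ∋ 3`, from rank-one data over `K` (SketchE.lean `example`)
  have hfinE : ∀ (v : HeightOneSpectrum (𝓞 K)), ((3 : ℕ) : 𝓞 K) ∈ v.asIdeal →
      Finite (selmerAcBase (W.baseChange K) 3 v ∅) := by
    intro v hv
    haveI : Finite (W.baseChange K).sha := hfin
    have hSha3 : Finite (AddCommGroup.primaryComponent (W.baseChange K).sha 3) := inferInstance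
    obtain ⟨he'', hf''⟩ := X11b.degreeOne_of_splitsIn hK.1 hsplit hv
    obtain ⟨hfinv, -⟩ :=
      SchneiderFreeAdditiveX3.natCard_selmerAcBase_mul_eq_of_rankOne_anyTorsion_shaPrimary W 3 K (hPT K)
        (localEulerPoincareCharacteristicFact_proof K) hK hsplit hrk hSha3 P hnt v hv he'' hf''
    exact hfinv
  -- «act E/F»: transport_T (♭T′ + wall + μ, through Flat_T): IMC EQUALITY for `E` at `L`
  have heq : (XAc.charIdeal (W.baseChange K) 3 κ 𝔭' ∅ γ).map (PowerSeries.map (toUnr 3)) =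
      Ideal.span {L} :=
    hT hPT hPT2 W W' (W.conductorNorm ℤ) (W'.conductorNorm ℤ) K Dt Dt' hO6 hsurj hr rfl hcong hW'ss rfl hK hHN
      hHN' hfinE κ hκ γ 𝔭 h𝔭 he hf 𝔭' h𝔭' hne ι' hind hn.1 hwan' ΩK Ωp L hΩK hΩp hBDP
  have hval' : L.HasValueAt 0 ((((u : unrIntegers 3) : unrIntegers 3) : ℂ_[3]) *
      (algebraMap ℚ_[3] ℂ_[3]
        (logOmega W 3 (embAt K 3 𝔭' h𝔭' he' hf') P / (Dt.c : ℚ_[3]))) ^ 2) :=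
    (SchneiderFreeAdditiveX3.hasValueAt_sq_logOmega_embAt_iff_of_rank_one W 3 hK.1 hrk h𝔭 he hf
      h𝔭' he' hf' P _ _ L).mpr hval
  have hc0 : Dt.c ≠ 0 := Dt.maninConstant_ne_zero_holds
  have hlog : logOmega W 3 (embAt K 3 𝔭' h𝔭' he' hf') P ≠ 0 := X11b.R1.logOmega_ne_zero W 3 _ hnt
  have hlow : SchneiderFree.AdditiveIMCLowerBDPOnTreeLeAt 3 κ 𝔭' γ (embAt K 3 𝔭' h𝔭' he' hf')
      (padicValNat 3 Dt.c.natAbs) P := by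
    obtain ⟨htors, f, hfI, hf0, hfn⟩ := hn
    have hmem : PowerSeries.map (toUnr 3) f ∈ Ideal.span {L} := by
      have h3 := heq.le
      rw [hfI, CongruenceLimit.map_span_singleton_powerSeries] at h3
      exact (Ideal.span_singleton_le_iff_mem _).mp h3
    obtain ⟨-, hle⟩ := Supersingular.two_mul_valuation_le_of_mem_span 3 hf0 hmem u hval'
    have hc0' : (Dt.c : ℚ_[3]) ≠ 0 := by exact_mod_cast hc0
    rw [div_eq_mul_inv, Padic.valuation_mul hlog (inv_ne_zero hc0'), Padic.valuation_inv,
      Padic.valuation_intCast, valuation_logOmega hlog, hfn] at hle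
    refine ⟨n, ⟨htors, f, hfI, hf0, hfn⟩, ?_⟩
    simp only [padicValInt] at hle
    linarith
  have hup : SchneiderFree.Upper.AdditiveIMCUpperBDPOnTreeLeAt 3 κ 𝔭' γ (embAt K 3 𝔭' h𝔭' he' hf')
      (padicValNat 3 Dt.c.natAbs) P :=
    SchneiderFree.Upper.additiveIMCUpperBDPOnTreeLeAt_of_value_of_dvd' hn heq.ge u hc0 hlog hval'
  have hlo : SchneiderFree.IndexLowerBoundLeAt W 3 K P (padicValNat 3 Dt.c.natAbs) :=
    SchneiderFreeAdditiveX3.indexLowerBoundLeAt_of_imcLowerLe_of_control rfl hK hHN hfin hlow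
      ⟨n, hn, hneq⟩
  have hupI : SchneiderFree.Upper.IndexUpperBoundLeAt W 3 K P (padicValNat 3 Dt.c.natAbs) :=
    SchneiderFree.Upper.indexUpperBoundLeAt_of_imcUpperLe_of_control rfl hK hHN hfin hup ⟨n, hn, hneq⟩
  have hD0 : (NumberField.discr K : ℚ) ≠ 0 := by exact_mod_cast NumberField.discr_ne_zero K
  haveI : (W.quadraticTwist (NumberField.discr K : ℚ)).IsElliptic := W.isElliptic_quadraticTwist hD0
  obtain ⟨Cd, hCd⟩ := hasGlobalMinimalModel_rat_holds (W.quadraticTwist (NumberField.discr K : ℚ))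
  haveI : (Cd • W.quadraticTwist (NumberField.discr K : ℚ)).IsGloballyMinimal := hCd
  exact SchneiderFree.Exact.bsdp_three_of_exactIndexManin_of_wAllExclAddWildRankZero hGZ hKo hGZK hmod
    hGZ73 hZ W hO6 hsurj hr (W.conductorNorm ℤ) K Dt H ι P
    (Cd • W.quadraticTwist (NumberField.discr K : ℚ)) rfl hK hodd hHN hLt hP ⟨Cd, rfl⟩ hlo hupI

/-- p609468 §2 (`bsdp_three_of_flat_of_nonOrdBuckets_odd`) re-run on (Flat_T, package_T): the twin trichotomy; bucket B♭/C₀♭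
from the torsion-conditional package, bucket A from Yan–Zhu 5.7(1) (IMC equality ⟹ the clause with `k = 0`, the torsion
hypothesis unused). [folklore] -/
theorem bsdp_three_of_flatT_of_nonOrdBucketsT_odd (hF : ToricPublishedInputs)
    (hPT : PoitouTateSelmerStructureDualityFact) (hPT2 : PoitouTateShaTateDualFact)
    (hT : ToricTransportModThreeFlatT) (hYZ : YanZhuMainConjectureInput) (h3 : TwinWanFrameAtThreeNonOrdBucketsT)
    (hsupply : ∀ (W : WeierstrassCurve ℚ) [W.IsElliptic] [W.IsGloballyMinimal], Additive.ClassO6 W 3 →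
      W.analyticRank = 1 → W.HasSurjectiveModNGaloisRep 3 → HasGoodSSTwinAtThree W →
      HasGoodSSApZeroTwinAtThree W)
    (hV : ∀ (W : WeierstrassCurve ℚ) [W.IsElliptic] [W.IsGloballyMinimal] (N : ℕ) [NeZero N] (K : Type)
      [Field K] [NumberField K] (Dt : ModularParametrizationData W N) (H : HeegnerDatum N (NumberField.discr K))
      (ι : K →+* ℂ) (P : (W.baseChange K).toAffine.Point),
      Additive.ClassO6 W 3 → W.HasSurjectiveModNGaloisRep 3 → W.analyticRank = 1 → W.conductorNorm ℤ = N →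
      IsImaginaryQuadratic K → SatisfiesHeegnerHypothesis N K → Odd (NumberField.discr K) →
      (W.quadraticTwist (NumberField.discr K : ℚ)).entireLFunction 1 ≠ 0 →
      (WeierstrassCurve.Affine.Point.map ι.toRatAlgHom) P = heegnerPointComplex Dt H → ¬ IsOfFinAddOrder P →
      ∀ (κ : ZpExtension K 3), κ.IsAnticyclotomic → ∀ (γ : absoluteGaloisGroup K) [Fact (κ.IsTopGenerator γ)]
        (𝔭 : HeightOneSpectrum (𝓞 K)) (h𝔭 : ((3 : ℕ) : 𝓞 K) ∈ 𝔭.asIdeal)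
        (he : 𝔭.asIdeal.ramificationIdx (𝓞 ℚ) = 1) (hf : 𝔭.asIdeal.inertiaDeg (𝓞 ℚ) = 1),
        ∃ ι' : PadicAlgCl 3 ≃+* ℂ, SchneiderFree.BranchInducesPrime 3 ι' 𝔭 ∧
          ∃ (ΩK : ℂ) (Ωp : ℂ_[3]) (L : UnrSeries 3), ΩK ≠ 0 ∧ Ωp ≠ 0 ∧ IsBDPLFunction ι' 𝔭 κ γ Dt.f ΩK Ωp L ∧
            ∃ u : (unrIntegers 3)ˣ, L.HasValueAt 0 ((((u : unrIntegers 3) : unrIntegers 3) : ℂ_[3]) *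
              (algebraMap ℚ_[3] ℂ_[3] (logOmega W 3 (embAt K 3 𝔭 h𝔭 he hf) P / (Dt.c : ℚ_[3]))) ^ 2))
    (hC : WildSplitControlAtThree) (hZ : WildRankZeroTwistAtThree) :
    ∀ (W : WeierstrassCurve ℚ) [W.IsElliptic] [W.IsGloballyMinimal], Additive.ClassO6 W 3 →
      W.analyticRank = 1 → W.HasSurjectiveModNGaloisRep 3 →
      (∃ (W' : WeierstrassCurve ℚ) (_ : W'.IsElliptic) (_ : W'.IsGloballyMinimal),
        O6.ModPCongruent W' W 3 ∧ ¬ Addv W' 3 ∧ W'.HasSurjectiveModNGaloisRep 3) → BSDp W 3 := by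
  -- adapted from p609468 §2 (utd-p1 g11)
  intro W _ _ hO6 hr hsurj htwin
  obtain ⟨hB, hS0⟩ := h3
  obtain ⟨W', hW'e, hW'm, hcong, hW'ss, hW'surj⟩ := htwin
  by_cases hgood : W'.HasGoodReductionAtPrime 3
  · by_cases hss : (3 : ℤ) ∣ W'.frobeniusTrace 3
    · obtain ⟨W'', hW''e, hW''m, hcong'', hW''ss, ha0⟩ :=
        hsupply W hO6 hr hsurj ⟨W', hW'e, hW'm, hcong, hgood, by exact_mod_cast hss⟩
      have hW''surj : W''.HasSurjectiveModNGaloisRep 3 := by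
        obtain ⟨e, he⟩ := hcong''
        refine GaloisImage.hasSurjectiveModNGaloisRep_of_torsionIso e.symm (fun σ Q ↦ ?_) hsurj
        apply e.injective
        rw [he, e.apply_symm_apply, e.apply_symm_apply]
      exact bsdp_three_of_twinWanFrameAtT_odd_flatT hF hPT hPT2 hT hV hC hZ W hO6 hr hsurj W'' hcong''
        (fun h ↦ h.1 hW''ss.1)
        (fun N' _ K _ _ Dt' hN hK hHK hodd κ hκ γ _ 𝔭 h𝔭 he hf 𝔭' h𝔭' hne ι' hι ↦
          hS0 W'' N' K Dt' hW''ss ha0 hW''surj hN hK hHK hodd κ hκ γ 𝔭 h𝔭 he hf 𝔭' h𝔭' hne ι' hι)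
    · refine bsdp_three_of_twinWanFrameAtT_odd_flatT hF hPT hPT2 hT hV hC hZ W hO6 hr hsurj W' hcong hW'ss ?_
      intro N' _ K _ _ Dt' hN hK hH hodd κ hκ γ _ 𝔭 h𝔭 he hf 𝔭' h𝔭' hne ι' hι
      obtain ⟨⟨ΩK, Ωp, L', hΩK, hΩp, hBDP'⟩, hall⟩ :=
        ThreeAdicImageOverK.twinSplitIMCAtThreeGoodOrd_of_yanZhu57 hYZ W' N' K Dt'
          ⟨hgood, by exact_mod_cast hss⟩ hW'surj hN hK hH hodd κ hκ γ 𝔭 h𝔭 he hf 𝔭' h𝔭' hne ι' hι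
      refine ⟨ΩK, Ωp, L', hΩK, hΩp, hBDP', fun _ ↦ ⟨0, fun G hG ↦ ?_⟩⟩
      rw [hall ΩK Ωp L' hΩK hΩp hBDP'] at hG
      simpa using hG
  · have hmult : W'.HasMultiplicativeReductionAtPrime 3 := by
      by_contra h
      exact hW'ss ⟨hgood, h⟩
    exact bsdp_three_of_twinWanFrameAtT_odd_flatT hF hPT hPT2 hT hV hC hZ W hO6 hr hsurj W' hcong hW'ss
      (fun N' _ K _ _ Dt' hN hK hHK hodd κ hκ γ _ 𝔭 h𝔭 he hf 𝔭' h𝔭' hne ι' hι ↦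
        hB W' N' K Dt' hmult hW'surj hN hK hHK hodd κ hκ γ 𝔭 h𝔭 he hf 𝔭' h𝔭' hne ι' hι)

/-- **kernel‴ `ToricKernelAtThreeApZeroOddDefectPTTOfPrint` HOLDS** — fully proved (no ticket left): Flat_T from ♭T′ + wall +
μ (§1), control from the two Poitou–Tate leaves, V♯ from LZZ + the E-port exactly as in kernel♭ p609468, then §2. [folklore] -/
theorem kernelF_proof : ToricKernelAtThreeApZeroOddDefectPTTOfPrint := by
  intro hF hD hA hM h3 hsupply hW hS hL hZ
  obtain ⟨hYZ, h1, h2⟩ := hL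
  obtain ⟨hH, hB', hLZZ⟩ := hW
  exact bsdp_three_of_flatT_of_nonOrdBucketsT_odd hF h1 h2 (flatT_of_defectPT_of_wall_of_mu hD hA hM) hYZ h3
    (fun W _ _ hO6 hr hsurj htwin ↦ hsupply W hO6 hr hsurj htwin)
    (UniversalToricDescentKernelOdd.wildSplitWaldspurgerAtThreeOdd_of_lzz_of_frameOdd hLZZ (hS hH hB'))
    (UniversalToricDescentControl.wildSplitControlAtThree_of_poitouTate h1 h2) hZ

/-! ## §3 Monotonicity (every registered line still closes the re-typed items) and the would-be `closes` -/

/-- ♭B ⟹ ♭B_T (drop the torsion hypothesis). [folklore] -/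
theorem twinWanFrameAtThreeMultT_of_mult (h : TwinWanFrameAtThreeMult) : TwinWanFrameAtThreeMultT := by
  intro W' _ _ N' _ K _ _ Dt' hm hsurj hN hK hH hodd κ hκ γ _ 𝔭 h𝔭 he hf 𝔭' h𝔭' hne ι' hι
  obtain ⟨ΩK, Ωp, L, hΩK, hΩp, hBDP, hk⟩ := h W' N' K Dt' hm hsurj hN hK hH hodd κ hκ γ 𝔭 h𝔭 he hf 𝔭' h𝔭' hne ι' hι
  exact ⟨ΩK, Ωp, L, hΩK, hΩp, hBDP, fun _ ↦ hk⟩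

/-- ♭C₀ ⟹ ♭C₀_T. [folklore] -/
theorem twinWanFrameAtThreeGoodSSApZeroT_of_goodSSApZero (h : TwinWanFrameAtThreeGoodSSApZero) :
    TwinWanFrameAtThreeGoodSSApZeroT := by
  intro W' _ _ N' _ K _ _ Dt' hg ha hsurj hN hK hH hodd κ hκ γ _ 𝔭 h𝔭 he hf 𝔭' h𝔭' hne ι' hι
  obtain ⟨ΩK, Ωp, L, hΩK, hΩp, hBDP, hk⟩ :=
    h W' N' K Dt' hg ha hsurj hN hK hH hodd κ hκ γ 𝔭 h𝔭 he hf 𝔭' h𝔭' hne ι' hι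
  exact ⟨ΩK, Ωp, L, hΩK, hΩp, hBDP, fun _ ↦ hk⟩

/-- package ⟹ package_T; in particular 20694 ∧ 23594 ⟹ package_T through p611873's monotonicity. [folklore] -/
theorem nonOrdBucketsT_of_nonOrdBuckets (h : TwinWanFrameAtThreeNonOrdBuckets) : TwinWanFrameAtThreeNonOrdBucketsT :=
  ⟨twinWanFrameAtThreeMultT_of_mult h.1, twinWanFrameAtThreeGoodSSApZeroT_of_goodSSApZero h.2⟩

/-- package_T glue (children ⟹ parent, `⟨·,·⟩`). [folklore] -/
theorem nonOrdBucketsT_glue : TwinWanFrameAtThreeMultT → TwinWanFrameAtThreeGoodSSApZeroT →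
    TwinWanFrameAtThreeNonOrdBucketsT := fun a b ↦ ⟨a, b⟩

/-- kernel‴ ⟹ kernel″ is NOT needed; conversely kernel‴ is STRONGER as an implication (weaker hypothesis h3_T), so the act-E
kernel″ item 26977 follows from `kernelF_proof` by monotonicity — displayed for the record. [folklore] -/
theorem kernelE_of_kernelF (h : ToricKernelAtThreeApZeroOddDefectPTTOfPrint) : ToricKernelAtThreeApZeroOddDefectPTOfPrint :=
  fun hF hD hA hM h3 hsupply hW hS hL hZ ↦ h hF hD hA hM (nonOrdBucketsT_of_nonOrdBuckets h3) hsupply hW hS hL hZ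

/-- **kernel″ (act E item stmt-BirchSwinnertonDyer-26977) HOLDS** — a by-product: `kernelE_of_kernelF kernelF_proof`. The type
is literally the route decl of rev 44. (Not proposed under Theorems by this width seat without the pen's word — the act-E
closer ticket may be held by another seat; available on request as a one-line file.) [folklore] -/
theorem toricKernelAtThreeApZeroOddDefectPTOfPrint_proof' : ToricKernelAtThreeApZeroOddDefectPTOfPrint :=
  kernelE_of_kernelF kernelF_proof

/-- **closes_F** — rev 44's deciding theorem with h3 ↦ package_T and hK ↦ kernel‴ (same by-name package hP). [folklore] -/
theorem closesF (hF : ToricPublishedInputs) (hP : ToricDefectWallMuAtThree) (h3 : TwinWanFrameAtThreeNonOrdBucketsT)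
    (hsupply : GoodSSApZeroTwinSupplyAtThree) (hW : WildSplitPrintedInputsAtThree) (hS : WildSplitFrameAtThreeOddOfPrint)
    (hL : ToricPrintedLeavesAtThree) (hZ : WildRankZeroTwistAtThree) (hK : ToricKernelAtThreeApZeroOddDefectPTTOfPrint) :
    Summit.BirchSwinnertonDyer.WAllExclAddWildRankOneSurjTwin :=
  Summit.BirchSwinnertonDyer.wAllExclAddWildRankOneSurjTwin_of_forall (hK hF hP.1 hP.2.1 hP.2.2 h3 hsupply hW hS hL hZ)

/-- **closes_F with hK DISCHARGED**: the registered leaf from the SEVEN remaining displayed hypotheses of rev 44 with the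
torsion-conditional package in place of h3. CONDITIONAL on every one of them; closes nothing by itself. [folklore] -/
theorem wAllExclAddWildRankOneSurjTwin_of_defectWallMu_of_nonOrdBucketsT_of_print
    (hF : ToricPublishedInputs) (hP : ToricDefectWallMuAtThree) (h3 : TwinWanFrameAtThreeNonOrdBucketsT)
    (hsupply : GoodSSApZeroTwinSupplyAtThree) (hW : WildSplitPrintedInputsAtThree) (hS : WildSplitFrameAtThreeOddOfPrint)
    (hL : ToricPrintedLeavesAtThree) (hZ : WildRankZeroTwistAtThree) :
    Summit.BirchSwinnertonDyer.WAllExclAddWildRankOneSurjTwin :=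
  closesF hF hP h3 hsupply hW hS hL hZ kernelF_proof

end Summit.BirchSwinnertonDyer.BirchSwinnertonDyer.Cruxes.TwinWanFrameAtThreeMult.ActF

end
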